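import Mathlib.GroupTheory.Complement
import Summits.MatrixMultiplication.OmegaCensus.DihC3SqDih

/-!
# ω-census, family (b3): conjecture C9 (a) in witness form — independent box cell sets lift from a subgroup with the index as factor

HONEST FRAMING (pub-omega census; verbatim): lottery ticket; floor = certified bounds/negative ranges.
Census BOOKKEEPING (conjecture C9 (a) of the cell, 'the box ratio is monotone under sections'; pub-omega stpp-1 gen 17): the
SUBGROUP half in the same witness form as `DihC3Sq.exists_indep_lift` (the quotient/surjection half, `DihC3SqDih`; the `BoxUseful` forms are `BoxUsefulSections`): an
independent cell set `I ⊆ H × Y × W` of a `3 × 3` box of a subgroup `H ≤ G` (distinct cells have word `E2 P P' ≠ 1`) gives an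
independent cell set of `#I · [G : H]` cells of a `3 × 3` box of `G` — all `(c·r, y, w)` over a right transversal `R` of `H`
(`exists_indep_lift_subgroup`; the construction of `BoxUseful.subgroup`, `BoxUsefulSections.lean`, with the count kept).  So
every lower bound `α(H;|H|,3,3) ≥ ρ|H|` propagates to `α(G;|G|,3,3) ≥ ρ|G|` for every overgroup, as the upper laws propagate
downwards.  Nothing here is progress on `ω`.
-/

namespace Summit.MatrixMultiplication.OmegaCensus.DihC3Sq

open Finset

variable {G : Type*} [Group G]

/-- **Lift of an independent cell set from a subgroup.** An independent cell set `I` of a `3 × 3` box of `H ≤ G` gives one of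
`#I · [G : H]` cells of a `3 × 3` box of `G` (cells `(c·r, y, w)`, `r` in a right transversal of `H`). [folklore] -/
theorem exists_indep_lift_subgroup [Fintype G] [DecidableEq G] (H : Subgroup G) [Fintype ↥H] {Y W : Finset ↥H}
    {I : Finset (↥H × ↥H × ↥H)} (hI : I ⊆ univ ×ˢ (Y ×ˢ W)) (hind : ∀ P ∈ I, ∀ P' ∈ I, P ≠ P' → E2 P P' ≠ 1) :
    ∃ (Y' W' : Finset G) (J : Finset (G × G × G)), #Y' = #Y ∧ #W' = #W ∧ J ⊆ univ ×ˢ (Y' ×ˢ W') ∧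
      (∀ P ∈ J, ∀ P' ∈ J, P ≠ P' → E2 P P' ≠ 1) ∧ #J = #I * H.index := by
  classical
  obtain ⟨R, hR, -⟩ := H.exists_isComplement_right 1
  have hRfin : R.Finite := Set.toFinite R
  have memRf : ∀ r, r ∈ hRfin.toFinset ↔ r ∈ R := fun r => Set.Finite.mem_toFinset hRfin
  have cardRf : hRfin.toFinset.card = H.index := by
    rw [← hR.ncard_right, Set.ncard_eq_toFinset_card R hRfin]
  have uniq : ∀ (h₁ h₂ : G) (r₁ r₂ : G), h₁ ∈ H → h₂ ∈ H → r₁ ∈ R → r₂ ∈ R →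
      h₁ * r₁ = h₂ * r₂ → h₁ = h₂ ∧ r₁ = r₂ := by
    intro h₁ h₂ r₁ r₂ hh₁ hh₂ hr₁ hr₂ heq
    have := @hR.1 (⟨h₁, hh₁⟩, ⟨r₁, hr₁⟩) (⟨h₂, hh₂⟩, ⟨r₂, hr₂⟩) (by simpa using heq)
    simp only [Prod.mk.injEq, Subtype.mk.injEq] at this
    exact this
  let lift : (↥H × ↥H × ↥H) × G → G × G × G := fun p => ((p.1.1 : G) * p.2, ((p.1.2.1 : G), (p.1.2.2 : G)))
  have lift_inj : Set.InjOn lift ↑(I ×ˢ hRfin.toFinset) := by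
    rintro ⟨c, r⟩ hcr ⟨c', r'⟩ hcr' heq
    simp only [coe_product, Set.mem_prod, mem_coe, memRf] at hcr hcr'
    simp only [lift, Prod.mk.injEq] at heq
    obtain ⟨h1, h23⟩ := heq
    obtain ⟨hx, hr⟩ := uniq _ _ _ _ c.1.2 c'.1.2 hcr.2 hcr'.2 h1
    have hc : c = c' := Prod.ext (Subtype.ext hx) (Prod.ext (Subtype.ext h23.1) (Subtype.ext h23.2))
    exact Prod.ext hc hr
  let emb : ↥H ↪ G := ⟨Subtype.val, Subtype.val_injective⟩
  set J : Finset (G × G × G) := (I ×ˢ hRfin.toFinset).image lift with hJ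
  refine ⟨Y.map emb, W.map emb, J, card_map _, card_map _, ?_, ?_, ?_⟩
  · intro P hP
    obtain ⟨⟨c, r⟩, hcr, rfl⟩ := mem_image.1 hP
    rw [mem_product] at hcr
    have hc := hI hcr.1
    simp only [mem_product, mem_univ, true_and] at hc
    simp only [lift, mem_product, mem_univ, true_and, mem_map, Function.Embedding.coeFn_mk, emb]
    exact ⟨⟨c.2.1, hc.1, rfl⟩, ⟨c.2.2, hc.2, rfl⟩⟩
  · intro P hP P' hP' hne hw
    obtain ⟨⟨c, r⟩, hcr, rfl⟩ := mem_image.1 hP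
    obtain ⟨⟨c', r'⟩, hcr', rfl⟩ := mem_image.1 hP'
    simp only [mem_product, memRf] at hcr hcr'
    -- the hidden `H`-word
    set k : ↥H := c.2.1 * c'.2.1⁻¹ * (c.2.2 * c'.2.2⁻¹) with hk
    have hkG : (k : G) = (c.2.1 : G) * (c'.2.1 : G)⁻¹ * ((c.2.2 : G) * (c'.2.2 : G)⁻¹) := by simp [hk]
    have hw' : (c.1 : G) * r * ((c'.1 : G) * r')⁻¹ * (k : G) = 1 := by
      rw [hkG]; simpa only [lift, E2, mul_assoc] using hw
    have hX : (c.1 : G) * r * ((c'.1 : G) * r')⁻¹ = (k : G)⁻¹ := eq_inv_of_mul_eq_one_left hw'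
    have hr : r = (c.1 : G)⁻¹ * (k : G)⁻¹ * (c'.1 : G) * r' := by
      have : r = ((c.1 : G)⁻¹) * ((c.1 : G) * r * ((c'.1 : G) * r')⁻¹) * ((c'.1 : G) * r') := by group
      rw [hX] at this; simpa only [mul_assoc] using this
    have hmem : (c.1 : G)⁻¹ * (k : G)⁻¹ * (c'.1 : G) ∈ H :=
      H.mul_mem (H.mul_mem (H.inv_mem c.1.2) (H.inv_mem k.2)) c'.1.2
    obtain ⟨-, hrr⟩ := uniq 1 ((c.1 : G)⁻¹ * (k : G)⁻¹ * (c'.1 : G)) r r' H.one_mem hmem hcr.2 hcr'.2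
      (by rw [one_mul]; exact hr)
    subst hrr
    have hcc : c ≠ c' := by
      rintro rfl; exact hne rfl
    have hH : ((E2 c c' : ↥H) : G) = 1 := by
      rw [show ((E2 c c' : ↥H) : G) = E2 ((c.1 : G), ((c.2.1 : G), (c.2.2 : G))) ((c'.1 : G), ((c'.2.1 : G), (c'.2.2 : G)))
        by simp [E2]]
      have h1 : (c.1 : G) * r * ((c'.1 : G) * r)⁻¹ = (c.1 : G) * (c'.1 : G)⁻¹ := by group
      have := hw; simp only [lift, E2] at this ⊢; rw [h1] at this; exact this
    exact hind c hcr.1 c' hcr'.1 hcc (Subtype.ext (by simpa using hH))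
  · rw [hJ, card_image_of_injOn lift_inj, card_product, cardRf]

end Summit.MatrixMultiplication.OmegaCensus.DihC3Sq
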